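/-
Copyright (c) 2026 the pub-hodgecm-mathlib formalisation cell (harness21).  Prover seat hodgecm-mathlib-K2E2-p09 (g0),
Track B «K2-LIT» ∕ h413, engine E2, unit «L2-COMPLETENESS» of the line `K2_E2_ThetaExhaustionByRigidity`, file #9: payment
of the socket `K2E2ThetaExhaustionByRigidity.L2Completeness.sig_K2E2L2OrthogonalReceiverOfNotMem` — A CLASS OUTSIDE A DISCRETE
CONSTITUENT `P` OF A DISCRETELY DECOMPOSABLE `L²` IS SEEN BY A DISCRETE CONSTITUENT ORTHOGONAL TO `P`.  2026-09-03.
-/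
import Literature.NumberTheory.Automorphic.AdelicUnitaryGroupSpectrum          -- ★ generic unitary datum `UnitaryGroup.adelicGroupData`, `rightRegular`, `L2`
import Literature.NumberTheory.Automorphic.HilbertRepOrthogonalDecomposition   -- ★ atomicity `IsUnitary.exists_isTopIrreducible_le_of_isDiscretelyDecomposable`
import HarnessLib

/-!
# K2_E2 road (h413 = stmt-HodgeConjecture-24833), unit «L2-COMPLETENESS», file #9:
# a vector outside a closed invariant subspace `W` of a discretely decomposable unitary representation has a
# non-zero projection onto some IRREDUCIBLE closed invariant subspace of `Wᗮ`

Cell `pub/hodgecm-mathlib` (D-0151), Track B (21-frontier RULING «PUSH BOTH» 2026-09-03, director req621∕req624, chair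
K2-lead «SKELETON LANDED K2E2» 2026-09-03T21:02Z), socket module
`Summits/HodgeConjecture/HodgeConjecture/Cruxes/H413/Lines/K2_E2_ThetaExhaustionByRigidity_L2Completeness.lean` (planner
K2E2-plan (g0), sha16 bb9ff41ab0a0bc84), socket **`sig_K2E2L2OrthogonalReceiverOfNotMem`** (#9, size M): for the generic
unitary datum `UnitaryGroup.adelicGroupData F E c N J`, an automorphic measure `μ` with `L²(μ)` discretely decomposable, a
discrete automorphic `P ≤ L²(μ)` and a class `θ ∉ P`, there is a discrete automorphic `P′` with `P′ ⟂ P` and `pr_{P′} θ ≠ 0`.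
It feeds socket #10 `sig_K2E2L2MemOfProjectionRigidity` (capture of a class by projection rigidity), the Hilbert-space half
of the tier-0 stub `stub_thetaClassCapture`.

THE MATHEMATICS (no theta series, no number theory: a statement about one unitary representation `π` on a Hilbert space
`H` whose irreducible closed invariant subspaces have dense span).  Let `W` be a closed invariant subspace and `v ∉ W`.
Let `S` be the set of IRREDUCIBLE closed invariant subspaces contained in `Wᗮ`, and `Z` the closed span of `W` together
with the members of `S`.  **`Z = H`.**  Indeed `Zᗮ` is closed and invariant; if it were non-zero it would contain an
irreducible closed invariant `A` (atomicity of the closed invariant subspaces of a discretely decomposable unitary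
representation — the tree's ★ `ContRepresentation.IsUnitary.exists_isTopIrreducible_le_of_isDiscretelyDecomposable`,
[Dixmier1977, 5.4.1], whose proof is the isometric part of a compressed projection); but `A ≤ Zᗮ ≤ Wᗮ` puts `A` in `S`,
so `A ≤ Z`, and `A ≤ Z ∩ Zᗮ = 0` — absurd.  Now if every `Q ∈ S` killed `v` (`pr_Q v = 0`, i.e. `v ⊥ Q`), then
`v′ := v − pr_W v ∈ Wᗮ` would be orthogonal to `W` and — since also `pr_W v ∈ W ⊥ Q` — to every `Q ∈ S`, hence to their
closed span `Z = H`; so `v′ = 0` and `v = pr_W v ∈ W`, contradicting `v ∉ W`.  Hence some irreducible `Q ≤ Wᗮ` has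
`pr_Q v ≠ 0`; at `π = R` on `L²(μ)` (unitary: ★ `AdelicGroupData.isUnitary_rightRegular`) this `Q` is the wanted discrete
automorphic `P′`, orthogonal to `P` because `Q ≤ Pᗮ`.  (The planner's sketch — irreducibility of the closure of
`pr_{Pᗮ}(Q)` by polar decomposition — is exactly what the cited atomicity lemma already encapsulates; nothing is re-proved.)

* §1 `mem_orthogonal_iSupClosure_of_forall` — a vector orthogonal to every member of a family of closed invariant subspaces
  is orthogonal to their closed span; **`exists_isTopIrreducible_le_orthogonal_starProjection_ne_zero`** — the generic
  Hilbert-space statement above (any group, any unitary discretely decomposable `π`).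
* §2 **`l2OrthogonalReceiverOfNotMem`** — `sig_K2E2L2OrthogonalReceiverOfNotMem` TOKEN FOR TOKEN (the hypothesis
  `[CompactSpace …]` of the socket is carried but not used: discrete decomposability is assumed outright).  Tie, checked
  at home by paste (the socket module is a `Lines/` workfile, not imported here):
  `example : type_of% @l2OrthogonalReceiverOfNotMem = type_of% @K2E2ThetaExhaustionByRigidity.L2Completeness.sig_K2E2L2OrthogonalReceiverOfNotMem := rfl`.

References: [Dixmier1977] J. Dixmier, *C\*-algebras* (1977), 5.4.1 and §13.1; [DeitmarEchterhoff2014] A. Deitmar,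
S. Echterhoff, *Principles of Harmonic Analysis*, 2nd ed. (2014), Cor. 6.1.9, Thm. 9.2.2; [BorelJacquet1979] A. Borel,
H. Jacquet, Corvallis PSPM 33.1 (1979), §4.6 (`L²_d` and its constituents).

HONEST LABEL: HC_CM is proved only modulo the 7 printed citations (2 remaining named inputs: hLiu418 =
stmt-HodgeConjecture-24832, h413 = stmt-HodgeConjecture-24833) until rung 0 closes; this file is a
`--supports stmt-HodgeConjecture-24833 --as helper` leaf of the K2_E2 road and retires nothing by itself.
-/

-- the mandated namespace repeats `HodgeConjecture.HodgeConjecture`, as in every `Theorems/*.lean` of this sub-problem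
set_option linter.dupNamespace false
set_option autoImplicit false

noncomputable section

open scoped InnerProductSpace
open MeasureTheory

namespace Summit.HodgeConjecture.HodgeConjecture.Cruxes.H413.K2E2L2OrthogonalReceiverOfNotMem

open ContRepresentation
open Literature.NumberTheory.Automorphic Literature.NumberTheory.Automorphic.UnitaryGroup

/-! ## §1  The generic Hilbert-space statement -/

section Hilbert

variable {G H : Type*} [Group G] [NormedAddCommGroup H] [InnerProductSpace ℂ H] [CompleteSpace H]
  {π : ContRepresentation ℂ G H}

/-- A vector orthogonal to every member of a family `S` of closed invariant subspaces is orthogonal to their closed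
span `iSupClosure S` (Mathlib `Submodule.orthogonal_closure`: `K̄ᗮ = Kᗮ`). [folklore] -/
theorem mem_orthogonal_iSupClosure_of_forall (hπ : π.IsUnitary) {S : Set (ClosedSubrep π)} {v : H}
    (h : ∀ Q ∈ S, v ∈ Q.toSubmoduleᗮ) : v ∈ (ClosedSubrep.iSupClosure S).orthogonal hπ := by
  set M : Submodule ℂ H := ⨆ Q ∈ S, (Q : ClosedSubrep π).toSubmodule with hM
  have hle : M ≤ (ℂ ∙ v)ᗮ :=
    iSup₂_le fun Q hQ u hu =>
      (Submodule.mem_orthogonal_singleton_iff_inner_left).mpr ((Submodule.mem_orthogonal _ _).mp (h Q hQ) u hu)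
  have hvM : v ∈ Mᗮ :=
    Submodule.orthogonal_le hle (Submodule.le_orthogonal_orthogonal _ (Submodule.mem_span_singleton_self v))
  change v ∈ M.topologicalClosureᗮ
  rwa [Submodule.orthogonal_closure]

/-- **A vector outside a closed invariant subspace `W` of a discretely decomposable unitary representation has a non-zero
orthogonal projection onto some IRREDUCIBLE closed invariant subspace of `Wᗮ`.**  With `S` the irreducible closed invariant
subspaces inside `Wᗮ` and `Z` the closed span of `W` and `S`: `Zᗮ = 0` (a non-zero `Zᗮ` contains an irreducible `A` by
atomicity, ★ `IsUnitary.exists_isTopIrreducible_le_of_isDiscretelyDecomposable`; `A ≤ Zᗮ ≤ Wᗮ` forces `A ∈ S`, `A ≤ Z`,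
`A = 0`); so if every `Q ∈ S` killed `v`, the vector `v − pr_W v` would be orthogonal to `Z = H`, i.e. `v = pr_W v ∈ W`.
[cite: Dixmier1977, 5.4.1] [cite: DeitmarEchterhoff2014, Cor. 6.1.9] -/
theorem exists_isTopIrreducible_le_orthogonal_starProjection_ne_zero (hπ : π.IsUnitary)
    (hd : π.IsDiscretelyDecomposable) (W : ClosedSubrep π) {v : H} (hv : v ∉ W) :
    ∃ Q : ClosedSubrep π, Q.toContRep.IsTopIrreducible ∧ Q ≤ W.orthogonal hπ ∧
      Q.toSubmodule.starProjection v ≠ 0 := by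
  set S : Set (ClosedSubrep π) := {Q | Q.toContRep.IsTopIrreducible ∧ Q ≤ W.orthogonal hπ} with hS
  -- Step 1: the closed span `Z` of `W` and of the irreducibles inside `Wᗮ` is everything.
  have hZ : ClosedSubrep.iSupClosure (insert W S) = ⊤ := by
    refine ClosedSubrep.eq_top_of_orthogonal_eq_bot hπ ?_
    by_contra hne
    obtain ⟨A, hA, hAle⟩ := hπ.exists_isTopIrreducible_le_of_isDiscretelyDecomposable hd hne
    have hWZ : W ≤ ClosedSubrep.iSupClosure (insert W S) :=
      ClosedSubrep.le_iSupClosure (Set.mem_insert W S)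
    have hAW : A ≤ W.orthogonal hπ := by
      intro u hu
      have hu' : u ∈ (ClosedSubrep.iSupClosure (insert W S)).toSubmoduleᗮ := hAle hu
      exact Submodule.orthogonal_le (ClosedSubrep.toSubmodule_le_iff.mpr hWZ) hu'
    have hAS : A ∈ insert W S := Set.mem_insert_of_mem W (show A ∈ S from ⟨hA, hAW⟩)
    exact ClosedSubrep.ne_bot_of_isTopIrreducible hA
      (ClosedSubrep.eq_bot_of_le_of_le_orthogonal hπ (ClosedSubrep.le_iSupClosure hAS) hAle)
  -- Step 2: if every irreducible inside `Wᗮ` killed `v`, then `v - pr_W v` would be orthogonal to `Z = ⊤`.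
  by_contra hcon
  push Not at hcon
  apply hv
  have hmem : ∀ Q ∈ insert W S, v - W.toSubmodule.starProjection v ∈ Q.toSubmoduleᗮ := by
    intro Q hQ
    rcases Set.mem_insert_iff.mp hQ with rfl | hQS
    · exact Submodule.sub_starProjection_mem_orthogonal v
    · obtain ⟨hQirr, hQle⟩ := show Q.toContRep.IsTopIrreducible ∧ Q ≤ W.orthogonal hπ from hQS
      have h1 : v ∈ Q.toSubmoduleᗮ :=
        (Submodule.starProjection_apply_eq_zero_iff _).mp (hcon Q hQirr hQle)
      have hWQ : W.toSubmodule ≤ Q.toSubmoduleᗮ :=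
        (Submodule.le_orthogonal_orthogonal W.toSubmodule).trans
          (Submodule.orthogonal_le (ClosedSubrep.toSubmodule_le_iff.mpr hQle))
      exact Submodule.sub_mem _ h1 (hWQ (Submodule.starProjection_apply_mem _ v))
  have hZ' : v - W.toSubmodule.starProjection v ∈
      ((ClosedSubrep.iSupClosure (insert W S)).orthogonal hπ).toSubmodule :=
    mem_orthogonal_iSupClosure_of_forall hπ hmem
  rw [hZ, ClosedSubrep.toSubmodule_orthogonal, ClosedSubrep.toSubmodule_top, Submodule.top_orthogonal_eq_bot,
    Submodule.mem_bot, sub_eq_zero] at hZ'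
  exact Submodule.starProjection_eq_self_iff.mp hZ'.symm

end Hilbert

/-! ## §2  The head: payment of `sig_K2E2L2OrthogonalReceiverOfNotMem` -/

/-- **PAYMENT OF `sig_K2E2L2OrthogonalReceiverOfNotMem`** (socket #9 of unit «L2-COMPLETENESS» of the K2_E2 road,
`Cruxes/H413/Lines/K2_E2_ThetaExhaustionByRigidity_L2Completeness.lean`, TOKEN FOR TOKEN): for the generic unitary datum
`UnitaryGroup.adelicGroupData F E c N J`, an automorphic `μ` with `L²(μ)` discretely decomposable, a discrete automorphic
`P` and a class `θ ∉ P`, some discrete automorphic `P′ ⟂ P` has `pr_{P′} θ ≠ 0` — §1 at the unitary regular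
representation (★ `AdelicGroupData.isUnitary_rightRegular`), `P′` being an irreducible closed invariant subspace of `Pᗮ`.
[cite: DeitmarEchterhoff2014, Thm. 9.2.2] [cite: BorelJacquet1979, §4.6] [cite: Dixmier1977, §13.1] -/
theorem l2OrthogonalReceiverOfNotMem :
    ∀ {F E : Type} [Field F] [NumberField F] [Field E] [NumberField E] [Algebra F E] {c : E ≃ₐ[F] E} {N : ℕ}
      {J : Matrix (Fin N) (Fin N) E} (μ : Measure (adelicGroupData F E c N J).automorphicQuotient)
      [(adelicGroupData F E c N J).IsAutomorphicMeasure μ] [CompactSpace (adelicGroupData F E c N J).automorphicQuotient],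
      ((adelicGroupData F E c N J).rightRegular μ).IsDiscretelyDecomposable →
      ∀ (P : DiscreteAutomorphicRep (adelicGroupData F E c N J) μ) (θ : (adelicGroupData F E c N J).L2 μ),
        θ ∉ P.space.toSubmodule →
        ∃ P' : DiscreteAutomorphicRep (adelicGroupData F E c N J) μ,
          P'.space.toSubmodule.IsOrtho P.space.toSubmodule ∧ P'.space.toSubmodule.starProjection θ ≠ 0 := by
  intro F E _ _ _ _ _ c N J μ _ _ hd P θ hθ
  obtain ⟨Q, hQirr, hQle, hQθ⟩ :=
    exists_isTopIrreducible_le_orthogonal_starProjection_ne_zero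
      ((adelicGroupData F E c N J).isUnitary_rightRegular μ) hd P.space hθ
  exact ⟨⟨Q, hQirr⟩, ClosedSubrep.isOrtho_of_le_orthogonal _ hQle, hQθ⟩

end Summit.HodgeConjecture.HodgeConjecture.Cruxes.H413.K2E2L2OrthogonalReceiverOfNotMem

end
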